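import Literature.Geometry.Lorentzian.TeukolskyWronskianBoundProofs
import Literature.Geometry.Lorentzian.KerrSurfaceGravity
import Literature.Geometry.Lorentzian.KerrSeparatedPotential
import HarnessLib

/-!
# The energy flux `Δ · Im(R̄ R′)` of the scalar (`s = 0`) radial Teukolsky / Carter ODE, I:
# conservation, the horizon value, the Wronskian–flux identity
# (Teixeira da Costa 2020, Prop. 2.20 "energy identity", Remark 5.1; DRSR 2014, §7.2 `Q^T`)

Companion of `TeukolskyWronskianBoundProofs.lean` (constancy / non-vanishing of the Wronskian
`𝔚 = Δ^{1+s}(R_𝓗 R_𝓘′ − R_𝓘 R_𝓗′)`, R. Teixeira da Costa, Commun. Math. Phys. 378 (2020) 705–781 =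
arXiv:1910.02854 [Costa2019]) for the SCALAR case `s = 0`, where the radial ODE
`Δ R″ + 2(r − M) R′ + (K²/Δ − λ − a²ω² + 2amω) R = 0` (`Kerr.IsRadialTeukolskySolution M a 0 ω m λ`)
has REAL coefficients for real `(ω, m, λ)`. In the variable `u = (r² + a²)^{1/2} R`, `′ = d/dr*`,
this is `u″ + (ω² − V)u = 0` with real `V`, and the frequency-localised energy current
`Q^T[u] = Im(u′ · \overline{ωu}) = ω · Im(ū u′)` (TdC §2.4.1, "T-current"; Dafermos–Rodnianski–
Shlapentokh-Rothman, arXiv:1402.7034, §7.2: `Q^T[u] = ω Im(u′ū)`, `(Q^T)′ = ω Im(H ū)`) is conserved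
for the homogeneous equation. Since `Im(ū du/dr*) = (Δ/(r²+a²)) Im(ū du/dr) = Δ · Im(R̄ dR/dr)`
(the factor `(r² + a²)^{1/2}` is real), the conserved quantity is, in the `r` variable,

  `F[R](r) := Δ(r) · Im( conj(R(r)) · R′(r) )`  (`= Q^T[u]/ω = (2i)⁻¹ · 𝔚(R̄, R)`).

TdC **Proposition 2.20** (energy identity for the homogeneous radial ODE, `s = 0`) evaluates
`Q^T` at `r* = ±∞` on the normalised solutions of Def. 2.3:
`ω²|a_{𝓘⁺}|² + ω(ω − mω₊)|a_{𝓗⁺}|² = ω²|a_{𝓘⁻}|² + ω(ω − mω₊)|a_{𝓗⁻}|²`. This file proves: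

* `Costa2019.isRadialTeukolskySolution_conj` — `conj R` solves with `R` (`s = 0`, real parameters);
* `Costa2019.radialFlux_eq` — `F[R]` takes the same value at any two radii `> r₊`
  (`(Q^T)′ = 0`; here from Remark 5.1 = `Costa2019.radialWronskian_eq` applied to `(R̄, R)`);
* `Costa2019.radialFlux_eq_of_normalisedHorizon` — for `R_𝓗` normalised at `𝓗⁺` as in Def. 2.3
  (`Kerr.IsNormalisedHorizonSolution`): `F[R_𝓗] ≡ −(ω − mω₊)` on `(r₊, ∞)` (the `𝓗⁺` boundary
  value of Prop. 2.20 — DRSR (5.x): `u′ + i(ω − mω₊)u = 0` at `r₊` —: `R = f·(r − r₊)^ξ`, `Re ξ = 0`,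
  `F = Δ Im(f̄ f′) + (r − r₋) Im ξ |f|² → (r₊ − r₋) Im ξ |f(r₊)|² = −(ω − mω₊)` by
  `|f(r₊)|²(r₊² + a²) = 1`, `r₊² + a² = 2Mr₊`; this covers the threshold `ω = mω₊`, `ξ = 0`);
* `Costa2019.norm_sq_radialWronskian_eq_conj`, `…_of_normalisedHorizon` — the pointwise
  determinant identity `|𝔚(R_𝓗,R_𝓘)|² = |𝔚(R̄_𝓗,R_𝓘)|² − 4 F[R_𝓗] F[R_𝓘]`, hence for `R_𝓗`
  normalised at `𝓗⁺` and any `R_𝓘`: `|𝔚(R_𝓗,R_𝓘)|² = |𝔚(R̄_𝓗,R_𝓘)|² + 4(ω − mω₊) F[R_𝓘]`;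
* `Costa2019.abs_omega_lower_of_cone` — elementary: `0 < M`, `0 < a₁ ≤ |a|`, `|ω − mω₊| ≤ ε₀|m|`
  give `(a₁/(4M²) − ε₀)|m| ≤ |ω|` (`|ω₊| ≥ a₁/(4M²)` as `r₊ ≤ 2M`), i.e. a cone around the
  superradiant threshold `ω = mω₊` stays away from `ω = 0`.

The `𝓘⁺` boundary value `F[R_𝓘] ≡ ω` (which needs the derivative asymptotics of the outgoing
expansion) and the resulting identity `|𝔚(R_𝓗,R_𝓘)|² = |𝔚(R̄_𝓗,R_𝓘)|² + 4ω(ω − mω₊)` are in the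
sequel `TeukolskyRadialFluxInfinity.lean`. Not here either: the `s ≠ 0` energy identity
(Prop. 2.21, Teukolsky–Starobinsky constant), the `𝓗⁻`/`𝓘⁻` normalisations, the extremal case
`|a| = M`. Everything is proved; theorems only.

## References
* R. Teixeira da Costa, CMP 378 (2020) 705–781 = arXiv:1910.02854: Def. 2.3, §2.4.1 (T-current),
  Proposition 2.20, Def. 5.1, Remark 5.1. [Costa2019]
* M. Dafermos, I. Rodnianski, Y. Shlapentokh-Rothman, *Decay for solutions of the wave equation on
  Kerr exterior spacetimes III*, Ann. of Math. 183 (2016) = arXiv:1402.7034: §5.3 (boundary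
  conditions `u′ + i(ω − mω₊)u = 0` at `r₊`, `u′ − iωu = 0` at `∞`), §7.2 (`Q^T`, `Q^K`).
  [DafermosRodnianskiShlapentokhrothman2014]
-/

noncomputable section

open Complex Set Filter Topology
open scoped ComplexConjugate

namespace Literature.Geometry.Lorentzian.Kerr

namespace Costa2019

/-! ### Real coefficients: `conj R` solves with `R` (`s = 0`) -/

/-- For `s = 0` and real `(ω, m, λ)` the radial Teukolsky ODE has real coefficients, so the
complex conjugate of a classical solution on `(r₊, ∞)` is again a classical solution with the same
parameters. [cite: Costa2019, §2.4.1] -/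
theorem isRadialTeukolskySolution_conj {M a ω m lam : ℝ} {R : ℝ → ℂ}
    (h : IsRadialTeukolskySolution M a 0 ω m lam R) :
    IsRadialTeukolskySolution M a 0 ω m lam (fun r => conj (R r)) := by
  obtain ⟨R', R'', hR⟩ := h
  refine ⟨fun r => conj (R' r), fun r => conj (R'' r), fun r hr => ?_⟩
  obtain ⟨h1, h2, h3⟩ := hR r hr
  refine ⟨h1.star, h2.star, ?_⟩
  have h4 := congrArg conj h3
  simp only [map_add, map_sub, map_mul, map_div₀, Complex.conj_ofReal, map_zero,
    map_ofNat, Complex.ofReal_zero, mul_zero, zero_mul, sub_zero, add_zero] at h4 ⊢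
  exact h4

/-- The derivative of `conj ∘ R` at a point where `R` is differentiable. [folklore] -/
theorem deriv_conj_eq {R : ℝ → ℂ} {r : ℝ} {R' : ℂ} (h : HasDerivAt R R' r) :
    deriv (fun y => conj (R y)) r = conj (deriv R r) := by
  rw [h.deriv]
  exact h.star.deriv

/-- `z̄ w − z w̄ = 2i · Im(z̄ w)`. [folklore] -/
private theorem conj_mul_sub_mul_conj (z w : ℂ) :
    conj z * w - z * conj w = 2 * I * ((conj z * w).im : ℂ) := by
  apply Complex.ext
  · simp
  · simp; ring

/-- `Im(d · (2i·x)) = 2·d·x` for real `d`, `x`. [folklore] -/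
private theorem im_ofReal_mul_two_I_mul (d x : ℝ) :
    (((d : ℝ) : ℂ) * (2 * I * ((x : ℝ) : ℂ))).im = 2 * (d * x) := by
  simp; ring

/-! ### `(Q^T)′ = 0`: the flux `Δ · Im(R̄ R′)` is constant (`s = 0`) -/

/-- **Conservation of the `T`-energy flux** (`s = 0`, `|a| ≤ M`): for a classical solution `R` of
the scalar radial Teukolsky ODE, `Δ(r) · Im(conj(R(r)) · R′(r))` (`= Q^T[u]/ω = (2i)⁻¹ 𝔚(R̄, R)`)
takes the same value at any two radii `> r₊`. [cite: Costa2019, Proposition 2.20 and Remark 5.1] -/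
theorem radialFlux_eq {M a ω m lam : ℝ} (ha : |a| ≤ M) {R : ℝ → ℂ}
    (h : IsRadialTeukolskySolution M a 0 ω m lam R) {r₁ r₂ : ℝ}
    (h₁ : rPlus M a < r₁) (h₂ : rPlus M a < r₂) :
    delta M a r₁ * (conj (R r₁) * deriv R r₁).im = delta M a r₂ * (conj (R r₂) * deriv R r₂).im := by
  have hW := radialWronskian_eq ha (isRadialTeukolskySolution_conj h) h h₁ h₂
  obtain ⟨R', R'', hR⟩ := h
  rw [radialWronskian_apply, radialWronskian_apply, deriv_conj_eq (hR r₁ h₁).1,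
    deriv_conj_eq (hR r₂ h₂).1, conj_mul_sub_mul_conj, conj_mul_sub_mul_conj, add_zero,
    Real.rpow_one, Real.rpow_one] at hW
  have him := congrArg Complex.im hW
  rw [im_ofReal_mul_two_I_mul, im_ofReal_mul_two_I_mul] at him
  linear_combination him / 2

/-! ### The flux of a horizon-normalised solution is `−(ω − mω₊)` -/

/-- `conj(t^ξ) · t^ξ = 1` for `t > 0` and `Re ξ = 0`. [folklore] -/
private theorem conj_cpow_mul_cpow {t : ℝ} (ht : 0 < t) {ξ : ℂ} (hξ : ξ.re = 0) :
    conj (((t : ℝ) : ℂ) ^ ξ) * ((t : ℝ) : ℂ) ^ ξ = 1 := by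
  rw [Complex.conj_mul', Complex.norm_cpow_eq_rpow_re_of_pos ht, hξ, Real.rpow_zero]
  simp

/-- **Collar identity.** If `R = f·(y − rp)^ξ` near `y` (`Re ξ = 0`, `f` differentiable at
`y > rp`), then `conj(R)·R′ = conj(f)·f′ + ξ‖f‖²/(y − rp)` at `y`. [folklore] -/
private theorem conj_mul_deriv_of_factor {R f : ℝ → ℂ} {rp y : ℝ} {ξ f' : ℂ} (hy : rp < y)
    (hξ : ξ.re = 0) (hf : HasDerivAt f f' y)
    (hRf : ∀ᶠ t in 𝓝 y, R t = f t * ((t - rp : ℝ) : ℂ) ^ ξ) :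
    conj (R y) * deriv R y = conj (f y) * f' + ξ * (((‖f y‖ ^ 2 / (y - rp) : ℝ)) : ℂ) := by
  have ht : (0 : ℝ) < y - rp := sub_pos.2 hy
  have hT : ((y - rp : ℝ) : ℂ) ≠ 0 := by exact_mod_cast ht.ne'
  set P : ℂ := ((y - rp : ℝ) : ℂ) ^ ξ with hP
  have e1 : conj P * P = 1 := conj_cpow_mul_cpow ht hξ
  -- `hasDerivAt_ofReal_sub_cpow` (TeukolskyRadialHeunForm): `d/dt (t − rp)^ξ = (t − rp)^ξ · ξ/(t − rp)`
  have hR : HasDerivAt R (f' * P + f y * (P * (ξ / ((y - rp : ℝ) : ℂ)))) y :=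
    (hf.mul (hasDerivAt_ofReal_sub_cpow rp ξ hy)).congr_of_eventuallyEq hRf
  have hRy : R y = f y * P := hRf.self_of_nhds
  rw [hR.deriv, hRy, map_mul, Complex.ofReal_div, div_eq_mul_inv, div_eq_mul_inv]
  have hnf : (((‖f y‖ ^ 2 : ℝ)) : ℂ) = conj (f y) * f y := by
    rw [Complex.conj_mul']; push_cast; ring
  rw [hnf]
  linear_combination (conj (f y) * f' + ξ * conj (f y) * f y * ((y - rp : ℝ) : ℂ)⁻¹) * e1

/-- **The `𝓗⁺` boundary value of the energy identity** (`s = 0`, `|a| < M`): for a classical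
radial solution normalised at `𝓗⁺` as in Def. 2.3 (`R(r)(r − r₊)^{−ξ} = f(r)` smooth at `r₊`,
`|f(r₊)|·(r₊² + a²)^{1/2} = 1`), `Δ(r)·Im(conj(R(r))·R′(r)) = −(ω − mω₊)` for every `r > r₊`
(DRSR: `u′ + i(ω − mω₊)u = 0` at `r = r₊`). [cite: Costa2019, Proposition 2.20] -/
theorem radialFlux_eq_of_normalisedHorizon {M a ω m lam : ℝ} (ha : |a| < M) {R : ℝ → ℂ}
    (hsol : IsRadialTeukolskySolution M a 0 ω m lam R)
    (hn : IsNormalisedHorizonSolution M a 0 ω m R) {r : ℝ} (hr : rPlus M a < r) :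
    delta M a r * (conj (R r) * deriv R r).im = -(ω - m * horizonAngularVelocity M a) := by
  obtain ⟨ε, hε, f, hf, hRf, hnorm⟩ := hn
  set ξ : ℂ := horizonExponent M a ω m with hξ
  have hξre : ξ.re = 0 := horizonExponent_re M a ω m
  have htop : ((⊤ : ℕ∞) : WithTop ℕ∞) ≠ 0 := by simp
  have hfd : ContDiffOn ℝ ((⊤ : ℕ∞) : WithTop ℕ∞) (deriv f) (Ioo (rPlus M a - ε) (rPlus M a + ε)) :=
    hf.deriv_of_isOpen isOpen_Ioo (by simp)
  -- Step 1: `R = f · (y − r₊)^ξ` on the collar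
  have hfac : ∀ y ∈ Ioo (rPlus M a) (rPlus M a + ε),
      R y = f y * ((y - rPlus M a : ℝ) : ℂ) ^ ξ := by
    intro y hy
    have hT : ((y - rPlus M a : ℝ) : ℂ) ≠ 0 := by exact_mod_cast (sub_pos.2 hy.1).ne'
    have hPne : ((y - rPlus M a : ℝ) : ℂ) ^ ξ ≠ 0 := fun h0 =>
      hT (Complex.cpow_eq_zero_iff _ _ |>.1 h0).1
    have h := hRf y hy
    rw [Complex.ofReal_zero, zero_sub, Complex.cpow_neg] at h
    rw [← h, mul_assoc, inv_mul_cancel₀ hPne, mul_one]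
  -- Step 2: the collar flux formula
  have hcollar : ∀ y ∈ Ioo (rPlus M a) (rPlus M a + ε),
      delta M a y * (conj (R y) * deriv R y).im =
        delta M a y * (conj (f y) * deriv f y).im + (y - rMinus M a) * ξ.im * ‖f y‖ ^ 2 := by
    intro y hy
    have hyI : Ioo (rPlus M a - ε) (rPlus M a + ε) ∈ 𝓝 y :=
      Ioo_mem_nhds (by linarith [hy.1]) hy.2
    have hfy : HasDerivAt f (deriv f y) y :=
      ((hf.differentiableOn htop y ⟨by linarith [hy.1], hy.2⟩).differentiableAt hyI).hasDerivAt
    have hev : ∀ᶠ t in 𝓝 y, R t = f t * ((t - rPlus M a : ℝ) : ℂ) ^ ξ := by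
      filter_upwards [Ioo_mem_nhds hy.1 hy.2] with t ht using hfac t ht
    rw [conj_mul_deriv_of_factor hy.1 hξre hfy hev, Complex.add_im, Complex.im_mul_ofReal,
      delta_eq_mul ha.le]
    have hy0 : y - rPlus M a ≠ 0 := (sub_pos.2 hy.1).ne'
    field_simp
  -- Step 3: the limit `y → r₊⁺`
  set h : ℝ → ℝ := fun y => delta M a y * (conj (f y) * deriv f y).im +
      (y - rMinus M a) * ξ.im * ‖f y‖ ^ 2 with hh
  have hI0 : Ioo (rPlus M a - ε) (rPlus M a + ε) ∈ 𝓝 (rPlus M a) :=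
    Ioo_mem_nhds (by linarith) (by linarith)
  have hfc : ContinuousAt f (rPlus M a) := hf.continuousOn.continuousAt hI0
  have hf'c : ContinuousAt (deriv f) (rPlus M a) := hfd.continuousOn.continuousAt hI0
  have hΔc : Continuous (delta M a) :=
    show Continuous fun y : ℝ => y ^ 2 - 2 * M * y + a ^ 2 by fun_prop
  have hcont : ContinuousAt h (rPlus M a) := by
    have h1 : ContinuousAt (fun y => (conj (f y) * deriv f y).im) (rPlus M a) :=
      Complex.continuous_im.continuousAt.comp
        ((Complex.continuous_conj.continuousAt.comp hfc).mul hf'c)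
    have h2 : ContinuousAt (fun y => ‖f y‖ ^ 2) (rPlus M a) := (hfc.norm).pow 2
    exact (hΔc.continuousAt.mul h1).add
      (((continuousAt_id.sub continuousAt_const).mul continuousAt_const).mul h2)
  have hlim1 : Tendsto h (𝓝[>] rPlus M a) (𝓝 (delta M a r * (conj (R r) * deriv R r).im)) := by
    refine (tendsto_const_nhds (x := delta M a r * (conj (R r) * deriv R r).im)).congr' ?_
    filter_upwards [Ioo_mem_nhdsGT (show rPlus M a < rPlus M a + ε by linarith)] with y hy
    rw [← radialFlux_eq ha.le hsol hy.1 hr, hcollar y hy]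
  have hlim2 : Tendsto h (𝓝[>] rPlus M a) (𝓝 (h (rPlus M a))) :=
    hcont.tendsto.mono_left nhdsWithin_le_nhds
  rw [tendsto_nhds_unique hlim1 hlim2, hh]
  simp only [delta_rPlus ha.le, zero_mul, zero_add]
  -- Step 4: evaluate `(r₊ − r₋) · Im ξ · |f(r₊)|²`
  have hξim : ξ.im = -(2 * M * rPlus M a / (rPlus M a - rMinus M a) *
      (ω - m * horizonAngularVelocity M a)) := by
    rw [hξ, horizonExponent]
    simp only [Complex.mul_im, Complex.neg_re, Complex.neg_im, Complex.I_re, Complex.I_im,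
      Complex.ofReal_re, Complex.ofReal_im, neg_zero, mul_zero, zero_add]
    ring
  have hd : rPlus M a - rMinus M a ≠ 0 :=
    (sub_pos.2 (IsSubextremal.rMinus_lt_rPlus (show IsSubextremal M a from ha))).ne'
  have hS : 0 ≤ rPlus M a ^ 2 + a ^ 2 := by positivity
  have hn1 : ‖f (rPlus M a)‖ ^ 2 * (2 * M * rPlus M a) = 1 := by
    rw [Real.rpow_zero, mul_one] at hnorm
    rw [← rPlus_sq_add_sq ha.le, ← Real.sq_sqrt hS, ← mul_pow, hnorm, one_pow]
  have e2 : (rPlus M a - rMinus M a) * (2 * M * rPlus M a / (rPlus M a - rMinus M a)) =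
      2 * M * rPlus M a := by
    field_simp
  rw [hξim]
  linear_combination -(ω - m * horizonAngularVelocity M a) * ‖f (rPlus M a)‖ ^ 2 * e2 -
    (ω - m * horizonAngularVelocity M a) * hn1

/-! ### The Wronskian–flux identity `|𝔚(R_𝓗,R_𝓘)|² = |𝔚(R̄_𝓗,R_𝓘)|² − 4 F[R_𝓗] F[R_𝓘]` -/

/-- Pointwise identity of `2 × 2` determinants over `ℂ`:
`|u v′ − v u′|² = |ū v′ − v ū′|² − 4·Im(ū u′)·Im(v̄ v′)` (the Hermitian form `Im(z̄₁ z₂)` on `ℂ²`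
has determinant `−1/4`). [folklore] -/
private theorem normSq_det_identity (u u' v v' : ℂ) :
    ‖u * v' - v * u'‖ ^ 2 =
      ‖conj u * v' - v * conj u'‖ ^ 2 - 4 * (conj u * u').im * (conj v * v').im := by
  simp only [Complex.sq_norm, Complex.normSq_apply, Complex.sub_re, Complex.sub_im, Complex.mul_re,
    Complex.mul_im, Complex.conj_re, Complex.conj_im]
  ring

/-- **Wronskian versus conjugate Wronskian** (`s = 0`, pointwise, `R_𝓗` differentiable at `r`,
any `R_𝓘`): `|𝔚(R_𝓗, R_𝓘)(r)|² = |𝔚(R̄_𝓗, R_𝓘)(r)|² − 4·(Δ Im(R̄_𝓗 R_𝓗′))·(Δ Im(R̄_𝓘 R_𝓘′))`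
(the algebra behind Prop. 2.20: expand `R_𝓗` in the basis `R_𝓘`, `R̄_𝓘` at `𝓘⁺`).
[cite: Costa2019, Proposition 2.20] -/
theorem norm_sq_radialWronskian_eq_conj {M a : ℝ} {RH RI : ℝ → ℂ} {r : ℝ} {RH' : ℂ}
    (hH : HasDerivAt RH RH' r) :
    ‖radialWronskian M a 0 RH RI r‖ ^ 2 =
      ‖radialWronskian M a 0 (fun y => conj (RH y)) RI r‖ ^ 2 -
        4 * (delta M a r * (conj (RH r) * deriv RH r).im) *
          (delta M a r * (conj (RI r) * deriv RI r).im) := by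
  rw [radialWronskian_apply, radialWronskian_apply, deriv_conj_eq hH, norm_mul, norm_mul, mul_pow,
    mul_pow, normSq_det_identity, add_zero, Real.rpow_one, Complex.norm_real, Real.norm_eq_abs,
    sq_abs]
  ring

/-- **`|𝔚(R_𝓗, R_𝓘)|² = |𝔚(R̄_𝓗, R_𝓘)|² + 4(ω − mω₊)·F[R_𝓘]`** (`s = 0`, `|a| < M`): for a
horizon-normalised classical solution `R_𝓗` and ANY `R_𝓘 : ℝ → ℂ`, at every `r > r₊`
(`norm_sq_radialWronskian_eq_conj` with `F[R_𝓗] = −(ω − mω₊)`). [cite: Costa2019, Proposition 2.20] -/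
theorem norm_sq_radialWronskian_of_normalisedHorizon {M a ω m lam : ℝ} (ha : |a| < M)
    {RH : ℝ → ℂ} (hH : IsRadialTeukolskySolution M a 0 ω m lam RH)
    (hnH : IsNormalisedHorizonSolution M a 0 ω m RH) (RI : ℝ → ℂ) {r : ℝ} (hr : rPlus M a < r) :
    ‖radialWronskian M a 0 RH RI r‖ ^ 2 =
      ‖radialWronskian M a 0 (fun y => conj (RH y)) RI r‖ ^ 2 +
        4 * (ω - m * horizonAngularVelocity M a) *
          (delta M a r * (conj (RI r) * deriv RI r).im) := by
  obtain ⟨RH', RH'', hRH⟩ := id hH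
  rw [norm_sq_radialWronskian_eq_conj (hRH r hr).1, radialFlux_eq_of_normalisedHorizon ha hH hnH hr]
  ring

/-! ### A cone around the superradiant threshold stays away from `ω = 0` -/

/-- **Lower bound for `|ω|` near the threshold `ω = mω₊`**: if `0 < M`, `0 < a₁ ≤ |a|` and
`|ω − mω₊| ≤ ε₀|m|` then `(a₁/(4M²) − ε₀)|m| ≤ |ω|` (`|ω₊| = |a|/(2Mr₊) ≥ a₁/(4M²)` as
`r₊ ≤ 2M`); in particular `ω ≠ 0` for `m ≠ 0` once `ε₀ < a₁/(4M²)`. [folklore] -/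
theorem abs_omega_lower_of_cone {M a₁ a ε₀ ω : ℝ} {m : ℤ} (hM : 0 < M) (ha₁ : 0 < a₁)
    (h₁ : a₁ ≤ |a|) (hcone : |ω - m * horizonAngularVelocity M a| ≤ ε₀ * |(m : ℝ)|) :
    (a₁ / (4 * M ^ 2) - ε₀) * |(m : ℝ)| ≤ |ω| := by
  have hrp : 0 < rPlus M a := rPlus_pos hM a
  have hr2 : rPlus M a ≤ 2 * M := rPlus_le_two_mul_self hM.le a
  have hΩ : a₁ / (4 * M ^ 2) ≤ |horizonAngularVelocity M a| := by
    rw [horizonAngularVelocity, abs_div, abs_of_pos (by positivity : 0 < 2 * M * rPlus M a),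
      div_le_div_iff₀ (by positivity) (by positivity)]
    calc a₁ * (2 * M * rPlus M a) ≤ a₁ * (2 * M * (2 * M)) := by gcongr
      _ = |a| * (4 * M ^ 2) - (|a| - a₁) * (4 * M ^ 2) := by ring
      _ ≤ |a| * (4 * M ^ 2) := by nlinarith
  have htri : |(m : ℝ)| * |horizonAngularVelocity M a| - ε₀ * |(m : ℝ)| ≤ |ω| := by
    have := abs_sub_abs_le_abs_sub ((m : ℝ) * horizonAngularVelocity M a) ω
    rw [abs_mul, abs_sub_comm] at this
    linarith
  have hm0 : 0 ≤ |(m : ℝ)| := abs_nonneg _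
  nlinarith [mul_le_mul_of_nonneg_left hΩ hm0]

end Costa2019

end Literature.Geometry.Lorentzian.Kerr

end
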